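import Summits.AtomisticToContinuum.Crystallization.Theorems.PricedLinkCensusStackingHingeSiteEnergyColumn
import Summits.AtomisticToContinuum.Crystallization.Theorems.PricedLinkCensusStackingHingeWordColumn
import Summits.AtomisticToContinuum.Crystallization.Theorems.PricedLinkCensusStackingHingeLjRegistryDomination
import Summits.AtomisticToContinuum.Crystallization.Theorems.PhononSlackCertificatesPeriodicGivenLayeredRegistry
import Summits.AtomisticToContinuum.Crystallization.Theorems.MinMeanCycleStackingLockBarlowEnergyIdentification
import Summits.AtomisticToContinuum.Crystallization.Theorems.ExcessDecayLiouvilleCoarseGrainsHcpEnergySeries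
import Summits.AtomisticToContinuum.Crystallization.Theorems.PalmUnimodularRigidityLayeredLawsSelectHcpDefs

/-!
# The Lennard-Jones site-energy column on item 3063's box (stub `stub_siteColumnLJ` of line
# `palm-good-law`, crux `ReggeStarCoercivity.DefectFreeCrystallizes`, stmt-AtomisticToContinuum-13603)

**Theorem** (`stub_siteColumnLJ`).  For `47/50 ≤ a ≤ 1`, `39/50·a ≤ h ≤ 17/20·a` the registry
couplings `J_k = barlowCoupling lennardJones a h k` have `J₃ − J₂ > 0`, and for every Hägg word `s`
and layer `m` the ideal own-word site energy dominates the hcp level `hcpE a h` with deficit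
`½ (J₃ − J₂)` per CUBIC adjacent side:
`hcpE a h + ½ (J₃ − J₂) · ([s (m+1) = s m] + [s (m−1) = s (m−2)]) ≤ barlowSiteEnergy lennardJones a h s m`.

**Proof** (assembly of landed pieces).
* `J₃ − J₂ > 0`: item 3063 (`PricedHcpWindowsLjRegistry.stub_ljRegistryDomination`) gives `J₂ < 0`
  and `Σ_{k ≥ 3} (k − 1)|J_k| ≤ |J₂|/2`; the single term `k = 3` gives `2|J₃| ≤ |J₂|/2`.
* The column `PricedHcpWindowsSiteEnergyColumn.stub_siteEnergyColumn` fed with the word column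
  `PricedHcpWindowsWordColumn.stub_wordColumn` (crux 14993); its hypotheses: summable layer
  interactions (`summable_layerInteraction_lennardJones`), and `J_k ≤ 0`, `J_k ≤ J_{k+1}` for
  `k ≥ 2` from `LayeredHull.stub_registry` after the reindexing
  `barlowCoupling V a h k = barlowCoupling V a (k h) 1` (`ljd_barlowCoupling_eq`), since
  `k h ≥ 39 a / 25` for `k ≥ 2`.
* Letters: for a `±1` word, `¬ HaggAligned s m 2 ↔ s (m + 1) = s m` (the window is
  `s m + s (m + 1)`), and the same at `m − 2`.
* The hcp level: `barlowSiteEnergy lennardJones a h alternatingHagg m' = hcpE a h`, by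
  `energyPerParticle_barlow_eq_average` (period `2`), layer independence of the hcp site energy
  (`barlowSiteEnergy_alternating_indep`) and `hcpEnergySeries_of_eq`.

All `[folklore]`.
-/

noncomputable section

namespace Summit.AtomisticToContinuum.Crystallization.Theorems.PalmGoodLaw.SiteColumnLJ

open Literature.MathematicalPhysics.StatisticalMechanics
open Summit.AtomisticToContinuum.Crystallization.Theorems.PalmUnimodularRigidity.LayeredLawsSelectHcp
  (hcpE hcpQ)
open Summit.AtomisticToContinuum.Crystallization.Theorems.ExcessDecayLiouvilleCoarseGrains
  (hcpEnergySeries_of_eq)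

/-! ## The coupling gap `J₃ − J₂ > 0` -/

/-- On item 3063's box, `0 < J₃ − J₂` for the Lennard-Jones registry couplings: `J₂ < 0` and the
`k = 3` term of the half-domination `Σ_{k ≥ 3} (k − 1)|J_k| ≤ |J₂|/2` gives `2|J₃| ≤ |J₂|/2`.
[folklore] -/
theorem coupling_gap_pos (a h : ℝ) (ha : 47 / 50 ≤ a) (ha1 : a ≤ 1) (hh : 39 / 50 * a ≤ h)
    (hh1 : h ≤ 17 / 20 * a) :
    0 < barlowCoupling lennardJones a h 3 - barlowCoupling lennardJones a h 2 := by
  obtain ⟨hS, hJ2, hT⟩ := PricedHcpWindowsLjRegistry.stub_ljRegistryDomination a h ha ha1 hh hh1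
  set J := barlowCoupling lennardJones a h with hJdef
  have hnn : ∀ k : ℕ, 0 ≤ (if 3 ≤ k then ((k : ℝ) - 1) * |J k| else 0) := by
    intro k
    split_ifs with hk
    · have hk' : (3 : ℝ) ≤ k := by exact_mod_cast hk
      exact mul_nonneg (by linarith) (abs_nonneg _)
    · exact le_rfl
  have hf : Summable fun k : ℕ => (if 3 ≤ k then ((k : ℝ) - 1) * |J k| else 0) := by
    refine Summable.of_nonneg_of_le hnn (fun k => ?_) hS
    split_ifs with hk
    · exact mul_le_mul_of_nonneg_right (by linarith) (abs_nonneg _)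
    · exact mul_nonneg (Nat.cast_nonneg _) (abs_nonneg _)
  have h3 := hf.le_tsum 3 (fun k _ => hnn k)
  have h3' : (if 3 ≤ (3 : ℕ) then (((3 : ℕ) : ℝ) - 1) * |J 3| else 0) = 2 * |J 3| := by
    norm_num
  rw [h3'] at h3
  have hJ2abs : |J 2| = -J 2 := abs_of_neg hJ2
  have hle : J 3 ≤ |J 3| := le_abs_self _
  have hge : -|J 3| ≤ J 3 := neg_abs_le _
  linarith

/-! ## Sign and monotonicity of the couplings from `k = 2` on -/

/-- On the box (only `47/50 ≤ a ≤ 1`, `39/50·a ≤ h` are used), the Lennard-Jones couplings satisfy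
`J_k ≤ 0` and `J_k ≤ J_{k+1}` for `k ≥ 2`: `LayeredHull.stub_registry` (the coupling
`H ↦ barlowCoupling lennardJones a H 1` is `≤ 0` and non-decreasing on `H ≥ 39a/25`) at the heights
`H = k h ≥ 2 h ≥ 39a/25`, after the landed reindexing `barlowCoupling V a h k = barlowCoupling V a (k h) 1`
(`PricedHcpWindowsLjDomination.ljd_barlowCoupling_eq`). [folklore] -/
theorem coupling_nonpos_mono (a h : ℝ) (ha : 47 / 50 ≤ a) (ha1 : a ≤ 1) (hh : 39 / 50 * a ≤ h) :
    (∀ k : ℕ, 2 ≤ k → barlowCoupling lennardJones a h k ≤ 0) ∧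
      (∀ k : ℕ, 2 ≤ k →
        barlowCoupling lennardJones a h k ≤ barlowCoupling lennardJones a h (k + 1)) := by
  obtain ⟨c₀, _, hreg⟩ := LayeredHull.stub_registry
  have hR := (hreg a ha ha1).1
  have hh0 : 0 ≤ h := by linarith
  have hk2 : ∀ k : ℕ, 2 ≤ k → 39 / 25 * a ≤ (k : ℝ) * h := fun k hk => by
    have hk' : (2 : ℝ) ≤ k := by exact_mod_cast hk
    nlinarith
  refine ⟨fun k hk => ?_, fun k hk => ?_⟩
  · rw [PricedHcpWindowsLjDomination.ljd_barlowCoupling_eq]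
    exact (hR _ _ (hk2 k hk) le_rfl).1
  · rw [PricedHcpWindowsLjDomination.ljd_barlowCoupling_eq lennardJones a h k,
      PricedHcpWindowsLjDomination.ljd_barlowCoupling_eq lennardJones a h (k + 1)]
    refine (hR _ _ (hk2 k hk) ?_).2
    push_cast
    nlinarith

/-! ## Letters: misalignment at range `2` as a letter equality -/

/-- For a `±1` word, the layers `m`, `m + 2` are NOT aligned iff `s (m + 1) = s m` (the window is
`s m + s (m + 1)`, which is `≡ 0 (mod 3)` iff the two letters differ), as an equality of real
indicators. [folklore] -/
theorem ite_not_aligned_two {s : ℤ → ℤ} (hs : IsHaggSeq s) (m : ℤ) :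
    ((if HaggAligned s m 2 then 0 else 1 : ℝ)) = (if s (m + 1) = s m then 1 else 0) := by
  have hw : haggWindow s m 2 = s m + s (m + 1) := by
    simp [haggWindow, Finset.sum_range_succ]
  show (if haggWindow s m 2 % 3 = 0 then (0 : ℝ) else 1) = _
  rw [hw]
  rcases hs m with h0 | h0 <;> rcases hs (m + 1) with h1 | h1 <;> simp [h0, h1]

/-- The same at the layer `m − 2`: the layers `m − 2`, `m` are NOT aligned iff
`s (m − 1) = s (m − 2)`. [folklore] -/
theorem ite_not_aligned_two_back {s : ℤ → ℤ} (hs : IsHaggSeq s) (m : ℤ) :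
    ((if HaggAligned s (m - 2) 2 then 0 else 1 : ℝ)) = (if s (m - 1) = s (m - 2) then 1 else 0) := by
  have h := ite_not_aligned_two hs (m - 2)
  rw [show m - 2 + 1 = m - 1 by ring] at h
  exact h

/-! ## The hcp level -/

/-- **The hcp site energy is the hcp level `hcpE a h`** (`a, h > 0`): the energy per particle of
`hcpPeriodicConfiguration` is the average of the two (equal) motif site energies
(`energyPerParticle_barlow_eq_average`, `barlowSiteEnergy_alternating_indep`) and equals `hcpE a h`
(`hcpEnergySeries_of_eq`). [folklore] -/
theorem barlowSiteEnergy_alternating_eq_hcpE {a h : ℝ} (ha : 0 < a) (hh : 0 < h) (m : ℤ) :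
    barlowSiteEnergy lennardJones a h alternatingHagg m = hcpE a h := by
  have hA := summable_layerInteraction_lennardJones ha hh 0
  have hN := summable_layerInteraction_lennardJones ha hh 1
  have hE : hcpE a h = (hcpPeriodicConfiguration ha.ne' hh.ne').energyPerParticle lennardJones :=
    ((hcpEnergySeries_of_eq a h ha.ne' hh.ne' hcpQ rfl).2.2).symm
  have h0 := PricedHcpWindowsSiteEnergyColumn.barlowSiteEnergy_alternating_indep lennardJones a h
    hA hN m ((0 : ℕ) : ℤ)
  have h1 := PricedHcpWindowsSiteEnergyColumn.barlowSiteEnergy_alternating_indep lennardJones a h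
    hA hN m ((1 : ℕ) : ℤ)
  rw [hE, hcpPeriodicConfiguration, energyPerParticle_barlow_eq_average ha hh ha.ne' hh.ne'
    two_ne_zero alternatingHagg_periodic, Finset.sum_range_succ, Finset.sum_range_one]
  push_cast at h0 h1 ⊢
  linarith

/-! ## The stub -/

/-- **S3 `stub_siteColumnLJ`: the Lennard-Jones site-energy column on item 3063's box.**  For
`47/50 ≤ a ≤ 1`, `39/50·a ≤ h ≤ 17/20·a` the registry couplings
`J_k = barlowCoupling lennardJones a h k` have `J₃ − J₂ > 0` (item 3063: `J₂ < 0`,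
`Σ_{k ≥ 3} (k − 1)|J_k| ≤ |J₂|/2`), and for every Hägg word `s` and layer `m` the ideal own-word
site energy dominates the hcp level with deficit `½ (J₃ − J₂)` per cubic adjacent side:
`hcpE a h + ½ (J₃ − J₂) · ([s (m+1) = s m] + [s (m−1) = s (m−2)]) ≤ barlowSiteEnergy lennardJones a h s m`.
Assembly: `stub_siteEnergyColumn` fed with `stub_wordColumn` (crux 14993), summable layer
interactions, `J_k ≤ 0` and `J_k ≤ J_{k+1}` for `k ≥ 2` (`LayeredHull.stub_registry` after
reindexing), the letter form of misalignment at range `2`, and the identification of the hcp site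
energy with `hcpE a h`. [folklore] -/
theorem stub_siteColumnLJ :
    ∀ a h : ℝ, 47 / 50 ≤ a → a ≤ 1 → 39 / 50 * a ≤ h → h ≤ 17 / 20 * a →
      0 < barlowCoupling lennardJones a h 3 - barlowCoupling lennardJones a h 2 ∧
      ∀ s : ℤ → ℤ, IsHaggSeq s → ∀ m : ℤ,
        Summit.AtomisticToContinuum.Crystallization.Theorems.PalmUnimodularRigidity.LayeredLawsSelectHcp.hcpE a h +
            (1 / 2) * (barlowCoupling lennardJones a h 3 - barlowCoupling lennardJones a h 2) *
              ((if s (m + 1) = s m then 1 else 0) + (if s (m - 1) = s (m - 2) then 1 else 0)) ≤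
          barlowSiteEnergy lennardJones a h s m := by
  intro a h ha ha1 hh hh1
  have ha0 : 0 < a := by linarith
  have hh0 : 0 < h := by linarith
  refine ⟨coupling_gap_pos a h ha ha1 hh hh1, fun s hs m => ?_⟩
  obtain ⟨hJ0, hJm⟩ := coupling_nonpos_mono a h ha ha1 hh
  have hcol := (PricedHcpWindowsSiteEnergyColumn.stub_siteEnergyColumn
    PricedHcpWindowsWordColumn.stub_wordColumn lennardJones a h s hs
    (summable_layerInteraction_lennardJones ha0 hh0 0)
    (summable_layerInteraction_lennardJones ha0 hh0 1) hJ0 hJm m m).2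
  rw [barlowSiteEnergy_alternating_eq_hcpE ha0 hh0, ite_not_aligned_two hs,
    ite_not_aligned_two_back hs] at hcol
  exact hcol

end Summit.AtomisticToContinuum.Crystallization.Theorems.PalmGoodLaw.SiteColumnLJ

end
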